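import Mathlib
import Literature.Analysis.FluidPDE.PoincareBall
import Literature.Analysis.FluidPDE.SuitableWeakRescaling
import Literature.Analysis.FluidPDE.SereginSverakPressureProofs
import Literature.Analysis.FluidPDE.BlowupFarField
import Literature.Analysis.FluidPDE.SereginSverak2002VertexBlowupLimit
import Literature.Analysis.FluidPDE.NSSuitableESS
import Literature.Analysis.FluidPDE.ESSLocalHolderHolds
import Literature.Analysis.FluidPDE.ESSLocalHolderBlowupLimit
import Literature.Analysis.FluidPDE.LocalTypeIScaling
import Literature.Analysis.FluidPDE.LocalTypeIPersistenceHolds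
import Literature.Analysis.FluidPDE.LocalTypeICongr
import Literature.Analysis.FluidPDE.LeraySuitableWeakSolutions
import Literature.Analysis.FluidPDE.NSWeakStrongUniquenessHolds
import Literature.Analysis.FluidPDE.TaoLocalisationHolds
import Literature.Analysis.FluidPDE.TaoLocalisationProofs
import Literature.Analysis.FluidPDE.KatoMaximalTimeSingular
import Literature.Analysis.FluidPDE.TypeIRateScaledEnergyBound
import Literature.Analysis.FluidPDE.SereginSverak2002PressureLowerBoundProofs
import Literature.Analysis.FluidPDE.NSLerayHopfABCScaling
import Literature.Analysis.FluidPDE.NSTimeRescaleClassical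
import Literature.Analysis.FluidPDE.NSViscosityRescaling
import Literature.Analysis.FluidPDE.TypeIAncientMildRescale
import Literature.Analysis.FluidPDE.SelfSimilar
import Literature.Analysis.FluidPDE.AncientAxisymmetricTypeILiouville
import Literature.Analysis.FluidPDE.CKNLocalEnergyEstimate
import Literature.Analysis.FluidPDE.CKNPressureEstimate
import Literature.Analysis.FluidPDE.CKNUnforcedOneScaleRRS
import Literature.Analysis.FluidPDE.CKNLocalRegularityRRSPressure
import Literature.Analysis.FluidPDE.RusinSverakSingularityStabilityEpsilon
import Literature.Analysis.FluidPDE.CKNScalingExtras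
import Literature.Analysis.FluidPDE.CKNLocalRegularityRRSStep3
import Literature.Analysis.FluidPDE.PineauVicolOneSliceProofs
import Literature.Analysis.FluidPDE.TsaiLocalEnergyProofs

/-!
# Rate floor for crux `ScarEnvelopeTypeI` (stmt-NavierStokesRegularity-23843) — Part O1–O2: the rate controls `C` by `A`; the CKN engines at a general cylinder

Part O1–O2 of the ROUND-35 plate («THE FLOOR IS A THEOREM»): O1 `cknC_le_of_rate` — a pointwise Type-I rate
`√(-t)‖u‖ ≤ ε` on `Q_r(z)` gives `C(r; z) ≤ 2ε·A(r; z)`; O2 the tree's local-energy master inequality transported to a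
general cylinder (`MasterIneq`, `localEnergy_master_scaled`) and the REAL forms `real_master`, `real_pressure'`.

PROVENANCE: declaration texts VERBATIM from the HOME plate of the instrument seat nsreg-p3 g26 (cell
`pub/ns-regularity-ideate`): `round-35/Tangent35prep.lean` v9 (sha16 `ce6f8ea4cb093fca`; = ROUND-34 plate v8
`84f56c3bc8f4da24` VERBATIM + Part O), scored PASS by referee ref3 g26 (`SCORE-p3-ROUND-35-0828.md`); the author cannot
write under `Theorems/` (`perm.theorems-prover-only`); landed by the prover ns-es-p1 g5 as landing hand of record
(director-ns DIRECTOR-NS #237 (3)), split into ≤ 400-line modules, namespace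
`Summit.NavierStokesRegularity.NavierStokesRegularity.Cruxes.ScarEnvelopeTypeI.ZoomDictionary.Floor` for the plate's `NsregP3.R35O` (and `Summit.NavierStokesRegularity.NavierStokesRegularity.Cruxes.ScarEnvelopeTypeI.ZoomDictionary`
for its `NsregP3.R30P`, as in the 26 landed dictionary / satellite-tower modules), `E3` spelled out, one-line
docstrings added where the plate had none.  `--supports stmt-NavierStokesRegularity-23843 --as helper`.

HONEST FRAMING: an effective ε-regularity INSTRUMENT inside the Type-I box, proved from the tree's CKN engines
(`localEnergy_master`, `pressureEstimate_holds`, `RRS2016.theorem15_3_holds`) — no compactness, no Liouville theorem,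
no hypothesis taken from print; it bears on the crux `TypeIQuarterGate.ScarEnvelopeTypeI` (item 23843) only through the
satellite-tower census (Part N's `SmallRateRegularity` hypothesis is discharged on bounded sub-classes).  NO open
statement is proved — 23843, its parent `QuarterLawTypeI`, the route and Navier–Stokes regularity are OPEN.
-/

-- the summit-side namespace repeats a component by design (single-conjunct summit, D-0017)
set_option linter.dupNamespace false

open MeasureTheory Set Metric Filter Topology
open scoped ENNReal NNReal InnerProductSpace
open Literature.Analysis.FluidPDE

namespace Summit.NavierStokesRegularity.NavierStokesRegularity.Cruxes.ScarEnvelopeTypeI.ZoomDictionary.Floor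

/-! ## O1. The rate controls `C` by `A`: `C(r; z) ≤ 2 ε A(r; z)` -/

/-- `∫_{(T - r², T)} K/√(-t) dt ≤ 2 K r` for a vertex `T ≤ 0` (translate to `T = 0`, where the
tree's `lintegral_Ioo_const_div_sqrt_neg` computes the integral exactly, and use
`1/√(-t) ≤ 1/√(-(t - T))`). -/
theorem lintegral_Ioo_const_div_sqrt_neg_le {r K T : ℝ} (hr : 0 ≤ r) (hK : 0 ≤ K) (hT : T ≤ 0) :
    ∫⁻ t in Ioo (T - r ^ 2) T, ENNReal.ofReal (K / Real.sqrt (-t)) ≤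
      ENNReal.ofReal (2 * K * r) := by
  have h1 : ∫⁻ t in Ioo (T - r ^ 2) T, ENNReal.ofReal (K / Real.sqrt (-t)) =
      ∫⁻ s in Ioo (-r ^ 2) 0, ENNReal.ofReal (K / Real.sqrt (-(s + T))) := by
    rw [← lintegral_indicator measurableSet_Ioo, ← lintegral_indicator measurableSet_Ioo,
      ← lintegral_add_right_eq_self
        (fun t => (Ioo (T - r ^ 2) T).indicator (fun t => ENNReal.ofReal (K / Real.sqrt (-t))) t) T]
    congr 1 with s
    have hiff : (s + T ∈ Ioo (T - r ^ 2) T) ↔ (s ∈ Ioo (-r ^ 2) 0) := by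
      simp only [mem_Ioo]
      constructor <;> rintro ⟨h1, h2⟩ <;> constructor <;> linarith
    by_cases hs : s ∈ Ioo (-r ^ 2) 0
    · rw [indicator_of_mem (hiff.mpr hs), indicator_of_mem hs]
    · rw [indicator_of_notMem (fun h => hs (hiff.mp h)), indicator_of_notMem hs]
  rw [h1, ← lintegral_Ioo_const_div_sqrt_neg hr hK]
  refine setLIntegral_mono' measurableSet_Ioo fun s hs => ?_
  refine ENNReal.ofReal_le_ofReal ?_
  have hs0 : 0 < -s := by linarith [hs.2]
  exact div_le_div_of_nonneg_left hK (Real.sqrt_pos.2 hs0)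
    (Real.sqrt_le_sqrt (by linarith))

/-- **O1 (the rate controls `C` by `A`).**  If `√(-t) |u(t, x)| ≤ ε` at every point of the
parabolic cylinder `Q_r(z)` whose vertex time is `z.1 ≤ 0`, then
`C(r; z) ≤ 2 ε · A(r; z)` (`C = cknC`, `A = cknAEss`): slice-wise
`∫_{B_r} |u|³ ≤ (ε/√(-t)) ∫_{B_r} |u|² ≤ (ε/√(-t)) r A` for a.e. `t`, and `∫ dt/√(-t) ≤ 2r` over
any time interval of length `r²` below `0`. [folklore interpolation; new use] -/
theorem cknC_le_of_rate {r ε : ℝ} (hr : 0 < r) (hε : 0 ≤ ε) {z : ℝ × (EuclideanSpace ℝ (Fin 3))} (hz : z.1 ≤ 0)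
    {u : ℝ → (EuclideanSpace ℝ (Fin 3)) → (EuclideanSpace ℝ (Fin 3))}
    (hu : AEStronglyMeasurable (Function.uncurry u) (volume.restrict (parabolicCylinder r z)))
    (hrate : ∀ t ∈ Ioo (z.1 - r ^ 2) z.1, ∀ x ∈ ball z.2 r, Real.sqrt (-t) * ‖u t x‖ ≤ ε) :
    cknC r z u ≤ ENNReal.ofReal (2 * ε) * cknAEss r z u := by
  set A := cknAEss r z u with hA
  have hr0 : ENNReal.ofReal r ≠ 0 := (ENNReal.ofReal_pos.2 hr).ne'
  have hrT : ENNReal.ofReal r ≠ ∞ := ENNReal.ofReal_ne_top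
  -- a.e. slice energy bound from the essential supremum
  have hslice : ∀ᵐ t ∂(volume.restrict (Ioo (z.1 - r ^ 2) z.1)),
      (ENNReal.ofReal r)⁻¹ * ∫⁻ x in ball z.2 r, ‖u t x‖ₑ ^ 2 ≤ A :=
    ENNReal.ae_le_essSup _
  -- slice-wise cubic bound
  have hcube : ∀ᵐ t ∂(volume.restrict (Ioo (z.1 - r ^ 2) z.1)),
      ∫⁻ x in ball z.2 r, (fun w : ℝ × (EuclideanSpace ℝ (Fin 3)) => ‖u w.1 w.2‖ₑ ^ (3 : ℕ)) (t, x) ≤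
        ENNReal.ofReal (ε / Real.sqrt (-t)) * (ENNReal.ofReal r * A) := by
    filter_upwards [hslice, ae_restrict_mem measurableSet_Ioo] with t ht htI
    have ht0 : 0 < -t := by linarith [htI.2]
    have hsq : 0 < Real.sqrt (-t) := Real.sqrt_pos.2 ht0
    have hpt : ∀ x ∈ ball z.2 r, ‖u t x‖ₑ ^ (3 : ℕ) ≤
        ENNReal.ofReal (ε / Real.sqrt (-t)) * ‖u t x‖ₑ ^ 2 := by
      intro x hx
      have hb : ‖u t x‖ ≤ ε / Real.sqrt (-t) := by
        rw [le_div_iff₀ hsq, mul_comm]; exact hrate t htI x hx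
      have hb' : ‖u t x‖ₑ ≤ ENNReal.ofReal (ε / Real.sqrt (-t)) := by
        rw [← ofReal_norm]; exact ENNReal.ofReal_le_ofReal hb
      calc ‖u t x‖ₑ ^ (3 : ℕ) = ‖u t x‖ₑ * ‖u t x‖ₑ ^ 2 := by ring
        _ ≤ ENNReal.ofReal (ε / Real.sqrt (-t)) * ‖u t x‖ₑ ^ 2 := by gcongr
    have hI2 : ∫⁻ x in ball z.2 r, ‖u t x‖ₑ ^ 2 ≤ ENNReal.ofReal r * A := by
      calc ∫⁻ x in ball z.2 r, ‖u t x‖ₑ ^ 2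
          = ENNReal.ofReal r * ((ENNReal.ofReal r)⁻¹ * ∫⁻ x in ball z.2 r, ‖u t x‖ₑ ^ 2) := by
            rw [← mul_assoc, ENNReal.mul_inv_cancel hr0 hrT, one_mul]
        _ ≤ ENNReal.ofReal r * A := by gcongr
    calc ∫⁻ x in ball z.2 r, ‖u t x‖ₑ ^ (3 : ℕ)
        ≤ ∫⁻ x in ball z.2 r, ENNReal.ofReal (ε / Real.sqrt (-t)) * ‖u t x‖ₑ ^ 2 :=
          setLIntegral_mono' measurableSet_ball hpt
      _ = ENNReal.ofReal (ε / Real.sqrt (-t)) * ∫⁻ x in ball z.2 r, ‖u t x‖ₑ ^ 2 := by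
          rw [lintegral_const_mul' _ _ ENNReal.ofReal_ne_top]
      _ ≤ ENNReal.ofReal (ε / Real.sqrt (-t)) * (ENNReal.ofReal r * A) := by gcongr
  -- integrate the slices
  have hg : AEMeasurable (fun w : ℝ × (EuclideanSpace ℝ (Fin 3)) => ‖u w.1 w.2‖ₑ ^ (3 : ℕ))
      (volume.restrict (parabolicCylinder r z)) := by
    have : AEMeasurable (fun w : ℝ × (EuclideanSpace ℝ (Fin 3)) => ‖Function.uncurry u w‖ₑ)
        (volume.restrict (parabolicCylinder r z)) := hu.aemeasurable.enorm
    exact this.pow_const 3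
  have hQ := RRS2016.lintegral_parabolicCylinder_le_of_ae_slice hg hcube
  have htime : ∫⁻ t in Ioo (z.1 - r ^ 2) z.1,
      ENNReal.ofReal (ε / Real.sqrt (-t)) * (ENNReal.ofReal r * A) ≤
        ENNReal.ofReal (2 * ε * r) * (ENNReal.ofReal r * A) := by
    rw [lintegral_mul_const'' _ (Measurable.aemeasurable (by
      exact ENNReal.measurable_ofReal.comp
        (measurable_const.div (Real.continuous_sqrt.measurable.comp measurable_neg))))]
    gcongr
    exact lintegral_Ioo_const_div_sqrt_neg_le hr.le hε hz
  have hmain : ∫⁻ w in parabolicCylinder r z, ‖u w.1 w.2‖ₑ ^ (3 : ℕ) ≤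
      ENNReal.ofReal (2 * ε * r) * (ENNReal.ofReal r * A) := hQ.trans htime
  -- divide by `r²`
  have hcan : (ENNReal.ofReal r ^ 2)⁻¹ * (ENNReal.ofReal r * ENNReal.ofReal r) = 1 := by
    rw [← sq, ENNReal.inv_mul_cancel (pow_ne_zero _ hr0) (ENNReal.pow_ne_top hrT)]
  calc cknC r z u = (ENNReal.ofReal r ^ 2)⁻¹ * ∫⁻ w in parabolicCylinder r z, ‖u w.1 w.2‖ₑ ^ (3 : ℕ) :=
        rfl
    _ ≤ (ENNReal.ofReal r ^ 2)⁻¹ * (ENNReal.ofReal (2 * ε * r) * (ENNReal.ofReal r * A)) := by gcongr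
    _ = (ENNReal.ofReal r ^ 2)⁻¹ * (ENNReal.ofReal r * ENNReal.ofReal r) *
          (ENNReal.ofReal (2 * ε) * A) := by
        rw [show (2 * ε * r : ℝ) = (2 * ε) * r by ring,
          ENNReal.ofReal_mul (by positivity : (0 : ℝ) ≤ 2 * ε)]
        ring
    _ = ENNReal.ofReal (2 * ε) * A := by rw [hcan, one_mul]

/-! ## O2. The CKN engines at a general cylinder, zero force, REAL form -/

/-- The tree's local-energy master inequality (`localEnergy_master`, RRS 2016 pp. 241–242, raw
form before Young) transported to a general cylinder `Q_r(z)` with `closure Q_r(z) ⊆ Q` by the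
Navier–Stokes zoom (pattern of `localEnergyEstimate_of_unitScale`), zero force. -/
def MasterIneq (cT c1 C4 : ℝ) : Prop :=
      ∀ (Q : TopologicalSpace.Opens (ℝ × (EuclideanSpace ℝ (Fin 3)))) (u : ℝ → (EuclideanSpace ℝ (Fin 3)) → (EuclideanSpace ℝ (Fin 3))) (p : ℝ → (EuclideanSpace ℝ (Fin 3)) → ℝ)
        (G : ℝ → (EuclideanSpace ℝ (Fin 3)) → (EuclideanSpace ℝ (Fin 3)) →L[ℝ] (EuclideanSpace ℝ (Fin 3))) (z : ℝ × (EuclideanSpace ℝ (Fin 3))) (r : ℝ), 0 < r →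
        IsSuitableWeakSolutionOn Q 1 0 u p → HasWeakSpatialGradientOn Q u G →
        closure (parabolicCylinder r z) ⊆ (Q : Set (ℝ × (EuclideanSpace ℝ (Fin 3)))) →
        cknAEss r z u ≠ ∞ → cknE r z G ≠ ∞ → cknC r z u ≠ ∞ → cknD r z p ≠ ∞ →
        ∀ θ : ℝ, 0 < θ → θ ≤ 1 / 2 →
          cknAEss (θ * r) z u + cknE (θ * r) z G ≤ ENNReal.ofReal (2 * cT) *
            (ENNReal.ofReal (cT * θ ^ 2 * c1) * cknC r z u ^ (2 / 3 : ℝ) +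
              ENNReal.ofReal (cT * C4 * (θ ^ 2)⁻¹) * (cknAEss r z u * cknE r z G) ^ (1 / 2 : ℝ) *
                cknC r z u ^ (1 / 3 : ℝ) +
              ENNReal.ofReal (2 * cT * (θ ^ 2)⁻¹) * cknD r z p ^ (2 / 3 : ℝ) *
                cknC r z u ^ (1 / 3 : ℝ))

/-- The tree's local-energy master inequality (`localEnergy_master`) holds at EVERY parabolic cylinder `Q_r(z)` with closure in the domain, zero force: `MasterIneq cT c1 C4` for the tree's constants (transport by the Navier–Stokes zoom `stPull`). -/
theorem localEnergy_master_scaled :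
    ∃ cT c1 C4 : ℝ, 0 < cT ∧ 0 ≤ c1 ∧ 0 ≤ C4 ∧ MasterIneq cT c1 C4 := by
  obtain ⟨cT, c1, C4, c2, hcT, hc1, hC4, hc2, H⟩ := localEnergy_master
  refine ⟨cT, c1, C4, hcT, hc1, hC4, fun Q u p G z r hr hsol hG hcl hAf hEf hCf hDf θ hθ hθ' => ?_⟩
  set Q' := stPreimage (r ^ 2) r z.1 z.2 Q with hQ'
  set u' := r • stPull (r ^ 2) r z.1 z.2 u with hu'
  set p' := r ^ 2 • stPull (r ^ 2) r z.1 z.2 p with hp'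
  set G' := r ^ 2 • stPull (r ^ 2) r z.1 z.2 G with hG'
  have hsol' : IsSuitableWeakSolutionOn Q' 1 0 u' p' := by
    have := hsol.stRescale (α := r) (β := r ^ 2) (γ := r) hr hr (by ring) z.1 z.2
    rwa [show r * 1 / r = 1 by field_simp, smul_stPull_zero_force] at this
  have hf'' : MemLp (Function.uncurry (0 : ℝ → (EuclideanSpace ℝ (Fin 3)) → (EuclideanSpace ℝ (Fin 3)))) (ENNReal.ofReal 3)
      (volume.restrict (Q' : Set (ℝ × (EuclideanSpace ℝ (Fin 3))))) := by
    simp [Function.uncurry_def]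
  have hG'' : HasWeakSpatialGradientOn Q' u' G' := by
    have := hG.stRescale r (by positivity : 0 < r ^ 2) hr z.1 z.2
    rwa [← sq] at this
  have hcl' := closure_parabolicCylinder_one_subset_stPreimage hr hcl
  have hz : stAffine (r ^ 2) r z.1 z.2 (0 : ℝ × (EuclideanSpace ℝ (Fin 3))) = z :=
    Prod.ext (by simp [stAffine]) (by simp [stAffine])
  have hA : ∀ ρ : ℝ, 0 < ρ → cknAEss ρ 0 u' = cknAEss (ρ * r) z u := fun ρ hρ => by
    rw [hu', cknAEss_nsZoom hr hρ z.1 z.2 0 u, hz, mul_comm]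
  have hE : ∀ ρ : ℝ, 0 < ρ → cknE ρ 0 G' = cknE (ρ * r) z G := fun ρ hρ => by
    rw [hG', cknE_nsZoom hr hρ z.1 z.2 0 G, hz, mul_comm]
  have hC : cknC 1 0 u' = cknC r z u := by
    rw [hu', cknC_nsZoom hr one_pos z.1 z.2 0 u, hz, mul_one]
  have hD : cknD 1 0 p' = cknD r z p := by
    rw [hp', cknD_nsZoom hr one_pos z.1 z.2 0 p, hz, mul_one]
  have hF : cknF 3 1 0 (0 : ℝ → (EuclideanSpace ℝ (Fin 3)) → (EuclideanSpace ℝ (Fin 3))) = 0 := cknF_zero_force (by norm_num) 1 0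
  have hA1 : cknAEss 1 0 u' ≠ ∞ := by rw [hA 1 one_pos, one_mul]; exact hAf
  have hE1 : cknE 1 0 G' ≠ ∞ := by rw [hE 1 one_pos, one_mul]; exact hEf
  have hC1 : cknC 1 0 u' ≠ ∞ := by rw [hC]; exact hCf
  have hD1 : cknD 1 0 p' ≠ ∞ := by rw [hD]; exact hDf
  have hF1 : cknF 3 1 0 (0 : ℝ → (EuclideanSpace ℝ (Fin 3)) → (EuclideanSpace ℝ (Fin 3))) ≠ ∞ := by rw [hF]; exact ENNReal.zero_ne_top
  have key := H Q' 3 0 u' p' G' hsol' (by norm_num) hf'' hG'' hcl' hA1 hE1 hC1 hD1 hF1 θ hθ hθ'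
  rw [hA θ hθ, hE θ hθ, hA 1 one_pos, hE 1 one_pos, one_mul, hC, hD, hF,
    ENNReal.zero_rpow_of_pos (by norm_num : (0 : ℝ) < 1 / 3), mul_zero, zero_mul, add_zero] at key
  exact key

/-- Real form of the scaled master inequality for `E(θ r)` (all quantities finite). -/
theorem real_master {A' E' A E C D : ℝ≥0∞} {cT c1 C4 θ : ℝ} (hcT : 0 < cT) (hc1 : 0 ≤ c1)
    (hC4 : 0 ≤ C4) (hθ : 0 < θ)
    (h : A' + E' ≤ ENNReal.ofReal (2 * cT) *
      (ENNReal.ofReal (cT * θ ^ 2 * c1) * C ^ (2 / 3 : ℝ) +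
        ENNReal.ofReal (cT * C4 * (θ ^ 2)⁻¹) * (A * E) ^ (1 / 2 : ℝ) * C ^ (1 / 3 : ℝ) +
        ENNReal.ofReal (2 * cT * (θ ^ 2)⁻¹) * D ^ (2 / 3 : ℝ) * C ^ (1 / 3 : ℝ)))
    (hA : A ≠ ∞) (hE : E ≠ ∞) (hC : C ≠ ∞) (hD : D ≠ ∞) :
    E'.toReal ≤ 2 * cT * (cT * θ ^ 2 * c1 * C.toReal ^ (2 / 3 : ℝ) +
      cT * C4 * (θ ^ 2)⁻¹ * (A.toReal * E.toReal) ^ (1 / 2 : ℝ) * C.toReal ^ (1 / 3 : ℝ) +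
      2 * cT * (θ ^ 2)⁻¹ * D.toReal ^ (2 / 3 : ℝ) * C.toReal ^ (1 / 3 : ℝ)) := by
  have hC23 : C ^ (2 / 3 : ℝ) ≠ ∞ := ENNReal.rpow_ne_top_of_nonneg (by norm_num) hC
  have hC13 : C ^ (1 / 3 : ℝ) ≠ ∞ := ENNReal.rpow_ne_top_of_nonneg (by norm_num) hC
  have hAE : (A * E) ^ (1 / 2 : ℝ) ≠ ∞ :=
    ENNReal.rpow_ne_top_of_nonneg (by norm_num) (ENNReal.mul_ne_top hA hE)
  have hD23 : D ^ (2 / 3 : ℝ) ≠ ∞ := ENNReal.rpow_ne_top_of_nonneg (by norm_num) hD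
  have hT1 : ENNReal.ofReal (cT * θ ^ 2 * c1) * C ^ (2 / 3 : ℝ) ≠ ∞ :=
    ENNReal.mul_ne_top ENNReal.ofReal_ne_top hC23
  have hT2 : ENNReal.ofReal (cT * C4 * (θ ^ 2)⁻¹) * (A * E) ^ (1 / 2 : ℝ) * C ^ (1 / 3 : ℝ) ≠ ∞ :=
    ENNReal.mul_ne_top (ENNReal.mul_ne_top ENNReal.ofReal_ne_top hAE) hC13
  have hT3 : ENNReal.ofReal (2 * cT * (θ ^ 2)⁻¹) * D ^ (2 / 3 : ℝ) * C ^ (1 / 3 : ℝ) ≠ ∞ :=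
    ENNReal.mul_ne_top (ENNReal.mul_ne_top ENNReal.ofReal_ne_top hD23) hC13
  have hR : ENNReal.ofReal (2 * cT) *
      (ENNReal.ofReal (cT * θ ^ 2 * c1) * C ^ (2 / 3 : ℝ) +
        ENNReal.ofReal (cT * C4 * (θ ^ 2)⁻¹) * (A * E) ^ (1 / 2 : ℝ) * C ^ (1 / 3 : ℝ) +
        ENNReal.ofReal (2 * cT * (θ ^ 2)⁻¹) * D ^ (2 / 3 : ℝ) * C ^ (1 / 3 : ℝ)) ≠ ∞ :=
    ENNReal.mul_ne_top ENNReal.ofReal_ne_top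
      (ENNReal.add_ne_top.2 ⟨ENNReal.add_ne_top.2 ⟨hT1, hT2⟩, hT3⟩)
  have hE'le : E' ≤ A' + E' := le_add_self
  have h1 : E'.toReal ≤ (ENNReal.ofReal (2 * cT) *
      (ENNReal.ofReal (cT * θ ^ 2 * c1) * C ^ (2 / 3 : ℝ) +
        ENNReal.ofReal (cT * C4 * (θ ^ 2)⁻¹) * (A * E) ^ (1 / 2 : ℝ) * C ^ (1 / 3 : ℝ) +
        ENNReal.ofReal (2 * cT * (θ ^ 2)⁻¹) * D ^ (2 / 3 : ℝ) * C ^ (1 / 3 : ℝ))).toReal :=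
    ENNReal.toReal_mono hR (hE'le.trans h)
  refine h1.trans (le_of_eq ?_)
  have h2θ : (0 : ℝ) ≤ (θ ^ 2)⁻¹ := by positivity
  rw [ENNReal.toReal_mul, ENNReal.toReal_add (ENNReal.add_ne_top.2 ⟨hT1, hT2⟩) hT3,
    ENNReal.toReal_add hT1 hT2, ENNReal.toReal_mul, ENNReal.toReal_mul, ENNReal.toReal_mul,
    ENNReal.toReal_mul, ENNReal.toReal_mul, ← ENNReal.toReal_rpow, ← ENNReal.toReal_rpow,
    ← ENNReal.toReal_rpow, ← ENNReal.toReal_rpow, ENNReal.toReal_mul,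
    ENNReal.toReal_ofReal (by positivity), ENNReal.toReal_ofReal (by positivity),
    ENNReal.toReal_ofReal (by positivity), ENNReal.toReal_ofReal (by positivity)]

/-- Real form of the tree's pressure estimate (all quantities finite). -/
theorem real_pressure' {D' A E D : ℝ≥0∞} {κ₅ κ₆ : ℝ≥0} {θ : ℝ} (hθ : 0 < θ)
    (h : D' ≤ κ₅ * ENNReal.ofReal (θ ^ (-(3 / 2 : ℝ))) * A ^ (3 / 4 : ℝ) * E ^ (3 / 4 : ℝ) +
      κ₆ * ENNReal.ofReal θ * D)
    (hA : A ≠ ∞) (hE : E ≠ ∞) (hD : D ≠ ∞) :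
    D' ≠ ∞ ∧ D'.toReal ≤ (κ₅ : ℝ) * θ ^ (-(3 / 2 : ℝ)) * A.toReal ^ (3 / 4 : ℝ) * E.toReal ^ (3 / 4 : ℝ) +
      (κ₆ : ℝ) * θ * D.toReal := by
  have hA34 : A ^ (3 / 4 : ℝ) ≠ ∞ := ENNReal.rpow_ne_top_of_nonneg (by norm_num) hA
  have hE34 : E ^ (3 / 4 : ℝ) ≠ ∞ := ENNReal.rpow_ne_top_of_nonneg (by norm_num) hE
  have hT1 : (κ₅ : ℝ≥0∞) * ENNReal.ofReal (θ ^ (-(3 / 2 : ℝ))) * A ^ (3 / 4 : ℝ) * E ^ (3 / 4 : ℝ) ≠ ∞ :=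
    ENNReal.mul_ne_top (ENNReal.mul_ne_top (ENNReal.mul_ne_top (by simp) ENNReal.ofReal_ne_top)
      hA34) hE34
  have hT2 : (κ₆ : ℝ≥0∞) * ENNReal.ofReal θ * D ≠ ∞ :=
    ENNReal.mul_ne_top (ENNReal.mul_ne_top (by simp) ENNReal.ofReal_ne_top) hD
  have hR : (κ₅ : ℝ≥0∞) * ENNReal.ofReal (θ ^ (-(3 / 2 : ℝ))) * A ^ (3 / 4 : ℝ) * E ^ (3 / 4 : ℝ) +
      κ₆ * ENNReal.ofReal θ * D ≠ ∞ := ENNReal.add_ne_top.2 ⟨hT1, hT2⟩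
  refine ⟨ne_top_of_le_ne_top hR h, ?_⟩
  have h1 := ENNReal.toReal_mono hR h
  refine h1.trans (le_of_eq ?_)
  rw [ENNReal.toReal_add hT1 hT2, ENNReal.toReal_mul, ENNReal.toReal_mul, ENNReal.toReal_mul,
    ENNReal.toReal_mul, ENNReal.toReal_mul, ← ENNReal.toReal_rpow, ← ENNReal.toReal_rpow,
    ENNReal.coe_toReal, ENNReal.coe_toReal, ENNReal.toReal_ofReal (Real.rpow_nonneg hθ.le _),
    ENNReal.toReal_ofReal hθ.le]

end Summit.NavierStokesRegularity.NavierStokesRegularity.Cruxes.ScarEnvelopeTypeI.ZoomDictionary.Floor
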